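import Mathlib
import Summits.ResolutionOfSingularities.ResolutionOfSingularities.Theorems.WildQuotientsWildQuotientResolutionJordanFiveChart0Fixed
import Summits.ResolutionOfSingularities.ResolutionOfSingularities.Theorems.WildQuotientsWildQuotientResolutionJordanThreeTwoRootChart

/-!
# N4a (`𝔸ⁿ/(J₃ ⊕ J₂)`, `p ≥ 3`), `μ₂`-vertex: the invariants of the chart subring are the slot image of the weight-`0` part

(crux stmt-ResolutionOfSingularities-15640 `WildQuotients.WildQuotientResolution`, line `Sketch`;
post-V5 width target N4a `JordanThreeTwo.jordanThreeTwo_hasResolution` (res-L1-w45c-plan-1 NO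
OBJECTION 2026-08-27T14:24:34Z), file R2 of res-L1-w45c-stub-2's plan 14:24:14Z; the J₃ ⊕ J₂ twin of
res-type-036's `JordanFive.chart0_fixedPoints_eq_map` (p525294) and of res-L1-w45c-stub-1's
`JordanFour.chart0_fixedPoints_eq_map`. [OURS · L1 W4.5c] — NOT a statement of any manuscript;
replaces the role of no printed item. Def-free.)

Root chart `U₀ = k[u, b, x_c, f, x_e, passengers]` of the `x_a`-vertex chart of the `(2,1,1)`-weighted
blow-up of `V(x_a, x_b, x_d)` for `σ = J₃ ⊕ J₂` (slots `u = X a`, `b = X b`, `f = X d`; `x_a = u²`,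
`x_b = ub`, `x_d = uf`), so the chart ring is the weight-`0` part of the `μ₂`-WEIGHT
`w₂ : (a, b, d) ↦ (1, 1, 1)`, `0` elsewhere (`ZMod 2`-valued). The lifted action `σ_U` (`b ↦ b + u`,
`x_c ↦ x_c + ub`, `x_e ↦ x_e + uf`) has fixed ring `k[N, γ₂″, Z₁, u, f, passengers]`
(`JordanThreeTwo.rootChart32_fixedPoints_eq`), generators `w₂`-homogeneous of weights `(p̄, 0, 0)`.

* `chart0_fixedPoints_eq_map`: for the slot substitution `θ : X b ↦ N, X c ↦ γ₂″, X e ↦ Z₁, X i ↦ X i`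
  and ANY subalgebra `R` which is the weight-`0` part of a weight `w₁` with
  `w₁ (a, b, d) = (1, p̄, 1)`, `0` elsewhere: `{f | IsWeightedHomogeneous w₂ f 0 ∧ σ_U f = f} = θ(R)`
  (`p` prime `≥ 3`; since `p̄ = 1` the cone is `½(1,1,1) × 𝔸^{n−3}` — downstream, `Half111`).
-/

-- single-problem summit: the doubled namespace component `ResolutionOfSingularities` is forced
set_option linter.dupNamespace false

noncomputable section

open MvPolynomial

namespace Summit.ResolutionOfSingularities.ResolutionOfSingularities.Theorems.WildQuotientResolution.JordanThreeTwo

variable (k : Type) [Field k] (n : ℕ)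
  (σU : MvPolynomial (Fin n) k ≃ₐ[k] MvPolynomial (Fin n) k) (a b c d e : Fin n)
  (hab : a ≠ b) (hac : a ≠ c) (had : a ≠ d) (hae : a ≠ e) (hbc : b ≠ c) (hbd : b ≠ d)
  (hbe : b ≠ e) (hcd : c ≠ d) (hce : c ≠ e) (hde : d ≠ e)
  (hb : σU (X b) = X b + X a) (hc : σU (X c) = X c + X a * X b) (he : σU (X e) = X e + X a * X d)
  (hσ : ∀ i, i ≠ b → i ≠ c → i ≠ e → σU (X i) = X i)

include hab hac hae hbc hbd hbe hcd hce hde hb hc he hσ in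
/-- **R2 core (`J₃ ⊕ J₂`, `μ₂`-vertex).** `{f | f has μ₂-weight 0 ∧ σ_U f = f} = θ(R)` for the slot
substitution `θ` (`X b ↦ N`, `X c ↦ γ₂″`, `X e ↦ Z₁`, rest fixed) and any subalgebra `R` equal to the
weight-`0` part of a `ZMod 2`-valued weight `w₁` with `w₁ a = 1`, `w₁ b = p`, `w₁ d = 1`, `w₁ = 0`
elsewhere; `w₂` is the `μ₂`-weight `(a,b,d) ↦ (1,1,1)`, `0` elsewhere; `p` prime `≥ 3`.
[OURS · L1 W4.5c] -/
theorem chart0_fixedPoints_eq_map (p : ℕ) (hp : p.Prime) (hp3 : 3 ≤ p) [CharP k p]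
    (w₂ : Fin n → ZMod 2) (hw₂a : w₂ a = 1) (hw₂b : w₂ b = 1) (hw₂d : w₂ d = 1)
    (hw₂0 : ∀ i, i ≠ a → i ≠ b → i ≠ d → w₂ i = 0)
    (w₁ : Fin n → ZMod 2) (hw₁a : w₁ a = 1) (hw₁b : w₁ b = (p : ZMod 2)) (hw₁d : w₁ d = 1)
    (hw₁0 : ∀ i, i ≠ a → i ≠ b → i ≠ d → w₁ i = 0)
    (R : Subalgebra k (MvPolynomial (Fin n) k)) (hR : ∀ P, P ∈ R ↔ IsWeightedHomogeneous w₁ P 0) :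
    {f : MvPolynomial (Fin n) k | IsWeightedHomogeneous w₂ f 0 ∧ σU f = f} =
      (R.map (aeval (fun i : Fin n => if i = b then X b ^ p - X a ^ (p - 1) * X b
          else if i = c then 2 * X c - X b ^ 2 + X a * X b
          else if i = e then X e - X b * X d
          else (X i : MvPolynomial (Fin n) k)) :
          MvPolynomial (Fin n) k →ₐ[k] MvPolynomial (Fin n) k) : Set (MvPolynomial (Fin n) k)) := by
  classical
  haveI : Fact p.Prime := ⟨hp⟩
  have hp1 : p - 1 + 1 = p := Nat.sub_add_cancel hp.one_lt.le
  have ha : σU (X a) = X a := hσ a hab hac hae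
  have hd : σU (X d) = X d := hσ d hbd.symm hcd.symm hde
  -- the invariants and the slot substitution `θ = aeval g`
  set N : MvPolynomial (Fin n) k := X b ^ p - X a ^ (p - 1) * X b with hN
  set γ2 : MvPolynomial (Fin n) k := 2 * X c - X b ^ 2 + X a * X b with hγ2
  set Z1 : MvPolynomial (Fin n) k := X e - X b * X d with hZ1
  let g : Fin n → MvPolynomial (Fin n) k := fun i =>
    if i = b then N else if i = c then γ2 else if i = e then Z1 else X i
  have hgb : g b = N := if_pos rfl
  have hgc : g c = γ2 := by
    change (if c = b then N else if c = c then γ2 else if c = e then Z1 else X c) = γ2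
    rw [if_neg (Ne.symm hbc), if_pos rfl]
  have hge : g e = Z1 := by
    change (if e = b then N else if e = c then γ2 else if e = e then Z1 else X e) = Z1
    rw [if_neg (Ne.symm hbe), if_neg (Ne.symm hce), if_pos rfl]
  have hgi : ∀ i, i ≠ b → i ≠ c → i ≠ e → g i = X i := by
    intro i hib hic hie
    change (if i = b then N else if i = c then γ2 else if i = e then Z1 else X i) = X i
    rw [if_neg hib, if_neg hic, if_neg hie]
  have hga : g a = X a := hgi a hab hac hae
  have hgd : g d = X d := hgi d hbd.symm hcd.symm hde
  -- `σ_U` fixes the images of `g`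
  have hσN : σU N = N :=
    ToricExit.rootChart4_artinSchreier (σU : MvPolynomial (Fin n) k →+* MvPolynomial (Fin n) k)
      a b ha hb p
  have hσ2 : σU γ2 = γ2 :=
    ToricExit.rootChart4_gamma_invariant (σU : MvPolynomial (Fin n) k →+* MvPolynomial (Fin n) k)
      a b c ha hb hc
  have hσZ : σU Z1 = Z1 :=
    rootChart32_Z_invariant (σU : MvPolynomial (Fin n) k →+* MvPolynomial (Fin n) k) a b d e hb hd he
  have hσg : ∀ i, σU (g i) = g i := by
    intro i
    by_cases hib : i = b
    · rw [hib, hgb, hσN]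
    by_cases hic : i = c
    · rw [hic, hgc, hσ2]
    by_cases hie : i = e
    · rw [hie, hge, hσZ]
    · rw [hgi i hib hic hie, hσ i hib hic hie]
  have hσθ : ∀ P : MvPolynomial (Fin n) k,
      σU ((aeval g : MvPolynomial (Fin n) k →ₐ[k] MvPolynomial (Fin n) k) P) =
        (aeval g : MvPolynomial (Fin n) k →ₐ[k] MvPolynomial (Fin n) k) P := by
    intro P
    have key : (σU : MvPolynomial (Fin n) k →ₐ[k] MvPolynomial (Fin n) k).comp (aeval g) =
        aeval g := by
      refine MvPolynomial.algHom_ext fun i => ?_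
      change σU (aeval g (X i)) = aeval g (X i)
      rw [aeval_X, hσg]
    exact congrArg (fun φ : MvPolynomial (Fin n) k →ₐ[k] MvPolynomial (Fin n) k => φ P) key
  -- weight bookkeeping: every `g i` is `w₂`-homogeneous of degree `w₁ i`
  have fixφ : ∀ {φ φ' : MvPolynomial (Fin n) k} {m m' : ZMod 2},
      IsWeightedHomogeneous w₂ φ m → φ = φ' → m = m' → IsWeightedHomogeneous w₂ φ' m' := by
    rintro φ φ' m m' h rfl rfl
    exact h
  have hsub : ∀ {φ ψ : MvPolynomial (Fin n) k} {m : ZMod 2}, IsWeightedHomogeneous w₂ φ m →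
      IsWeightedHomogeneous w₂ ψ m → IsWeightedHomogeneous w₂ (φ - ψ) m :=
    fun h1 h2 => (weightedHomogeneousSubmodule k w₂ _).sub_mem h1 h2
  have hX : ∀ i (m : ZMod 2), w₂ i = m →
      IsWeightedHomogeneous w₂ (X i : MvPolynomial (Fin n) k) m := by
    intro i m him
    have h := isWeightedHomogeneous_X k w₂ i
    rwa [him] at h
  have hXa := hX a 1 hw₂a
  have hXb := hX b 1 hw₂b
  have hXc := hX c 0 (hw₂0 c (Ne.symm hac) (Ne.symm hbc) hcd)
  have hXd := hX d 1 hw₂d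
  have hXe := hX e 0 (hw₂0 e (Ne.symm hae) (Ne.symm hbe) (Ne.symm hde))
  have hNw : IsWeightedHomogeneous w₂ N (p : ZMod 2) := by
    have h1 : IsWeightedHomogeneous w₂ (X b ^ p : MvPolynomial (Fin n) k) (p : ZMod 2) := by
      have h := hXb.pow p
      rwa [nsmul_eq_mul, mul_one] at h
    have h2 : IsWeightedHomogeneous w₂ (X a ^ (p - 1) * X b : MvPolynomial (Fin n) k)
        (p : ZMod 2) := by
      have h := (hXa.pow (p - 1)).mul hXb
      rwa [nsmul_eq_mul, mul_one, ← Nat.cast_add_one, hp1] at h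
    exact hsub h1 h2
  have hγ2w : IsWeightedHomogeneous w₂ γ2 0 := by
    have t1 : IsWeightedHomogeneous w₂ (2 * X c : MvPolynomial (Fin n) k) 0 :=
      fixφ (hXc.C_mul (2 : k)) (by rw [map_ofNat]) rfl
    have t2 : IsWeightedHomogeneous w₂ (X b ^ 2 : MvPolynomial (Fin n) k) 0 :=
      fixφ (hXb.pow 2) rfl (by decide)
    have t3 : IsWeightedHomogeneous w₂ (X a * X b : MvPolynomial (Fin n) k) 0 :=
      fixφ (hXa.mul hXb) rfl (by decide)
    exact (hsub t1 t2).add t3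
  have hZ1w : IsWeightedHomogeneous w₂ Z1 0 := by
    have t1 : IsWeightedHomogeneous w₂ (X b * X d : MvPolynomial (Fin n) k) 0 :=
      fixφ (hXb.mul hXd) rfl (by decide)
    exact hsub hXe t1
  have hgw : ∀ i, IsWeightedHomogeneous w₂ (g i) (w₁ i) := by
    intro i
    by_cases hia : i = a
    · rw [hia, hga, hw₁a]; exact hXa
    by_cases hib : i = b
    · rw [hib, hgb, hw₁b]; exact hNw
    by_cases hic : i = c
    · rw [hic, hgc, hw₁0 c (Ne.symm hac) (Ne.symm hbc) hcd]; exact hγ2w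
    by_cases hid : i = d
    · rw [hid, hgd, hw₁d]; exact hXd
    by_cases hie : i = e
    · rw [hie, hge, hw₁0 e (Ne.symm hae) (Ne.symm hbe) (Ne.symm hde)]; exact hZ1w
    · rw [hgi i hib hic hie, hw₁0 i hia hib hid]
      exact hX i 0 (hw₂0 i hia hib hid)
  -- `k[N, γ₂″, Z₁, X i (i ∉ {b,c,e})] ≤ range (aeval g)`
  have hFle : Algebra.adjoin k (({N, γ2, Z1} : Set (MvPolynomial (Fin n) k)) ∪
      ((fun i => X i) '' {i | i ≠ b ∧ i ≠ c ∧ i ≠ e})) ≤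
        (aeval g : MvPolynomial (Fin n) k →ₐ[k] MvPolynomial (Fin n) k).range := by
    refine Algebra.adjoin_le ?_
    rintro x hx
    rcases hx with hx | ⟨i, ⟨hib, hic, hie⟩, rfl⟩
    · simp only [Set.mem_insert_iff, Set.mem_singleton_iff] at hx
      rcases hx with rfl | rfl | rfl
      · exact (AlgHom.mem_range _).mpr ⟨X b, by rw [aeval_X, hgb]⟩
      · exact (AlgHom.mem_range _).mpr ⟨X c, by rw [aeval_X, hgc]⟩
      · exact (AlgHom.mem_range _).mpr ⟨X e, by rw [aeval_X, hge]⟩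
    · exact (AlgHom.mem_range _).mpr ⟨X i, by rw [aeval_X, hgi i hib hic hie]⟩
  apply Set.Subset.antisymm
  · -- `⊆`: a fixed weight-`0` `f` is `θ` of the weight-`0` part of a preimage
    rintro f ⟨hf0, hfσ⟩
    have hfF := mem_adjoin_of_rootChart32_eq k n σU a b c d e hab hac hae hbc hbd hbe hcd hce hde
      hb hc he hσ p hp hp3 f hfσ
    obtain ⟨P, hP⟩ := (AlgHom.mem_range _).mp (hFle hfF)
    have hcomp : f = aeval g (weightedHomogeneousComponent w₁ 0 P) := by
      rw [← JordanFour.weightedHomogeneousComponent_aeval w₁ w₂ g hgw P 0, hP]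
      exact (hf0.weightedHomogeneousComponent_same).symm
    rw [hcomp]
    exact Subalgebra.mem_map.mpr
      ⟨_, (hR _).mpr (weightedHomogeneousComponent_isWeightedHomogeneous 0 P), rfl⟩
  · -- `⊇`: `θ(R)` has weight `0` and is fixed
    rintro f hf
    obtain ⟨P, hPR, rfl⟩ := Subalgebra.mem_map.mp hf
    exact ⟨ToricExit.isWeightedHomogeneous_aeval w₁ w₂ g hgw P 0 ((hR P).mp hPR), hσθ P⟩

end Summit.ResolutionOfSingularities.ResolutionOfSingularities.Theorems.WildQuotientResolution.JordanThreeTwo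

end
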